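import Summits.ValiantsHypothesis.ValiantsHypothesis.Theses.VPBoundarySquare
import Literature.Computability.AlgebraicComplexity.SharpPBooleanPartsPPoly
import Literature.Computability.AlgebraicComplexity.RealTauConjectureAssembly
import HarnessLib

/-!
# VPBoundarySquare — the Boolean half of the CH collapse partner P_CH (decomp lens 3, NODE v8)

Under GRH, `VP_ℂ = VNP_ℂ` implies `CH ⊆ P/poly` — the Boolean-complexity input under which the
coefficient functions of `VCH⁰` families (route aside `CHClosureDefinable`, item 24721) become
`P/poly`-computable, i.e. the hypothesis of Valiant's criterion in exponential format (the
algebraic half of P_CH, open). Composition of two tree theorems; 0 sorry.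
-/

noncomputable section
set_option linter.dupNamespace false
open Literature.Computability.AlgebraicComplexity
open Literature.Computability.Complexity
open Literature.NumberTheory.LFunctions (ExtendedRiemannHypothesis)

namespace Summit.ValiantsHypothesis.ValiantsHypothesis.Theorems.VPBoundarySquareCHBooleanHalf
open Summit.ValiantsHypothesis.ValiantsHypothesis.Theses.VPBoundarySquare

/-- **Boolean half of P_CH.** Under GRH the collapse `VP_ℂ = VNP_ℂ` puts the counting hierarchy
in `P/poly`: `PP ⊆ P/poly` (Bürgisser 2000 Cor. 1.2, tree `PP_subset_PPoly_of_VP_eq_VNP`) and then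
`CH ⊆ P/poly` by the relativising induction (tree `CH_subset_PPoly_of_PP_subset_PPoly_holds`).
[cite: Burgisser2000, Cor. 1.2] [cite: Burgisser2026HNC, Cor. 4.12 (p. 14)] -/
theorem ch_subset_PPoly_of_ERH_of_collapse (hGRH : ExtendedRiemannHypothesis)
    (hEq : VP ℂ = VNP ℂ) : CH ⊆ PPoly :=
  CH_subset_PPoly_of_PP_subset_PPoly_holds (PP_subset_PPoly_of_VP_eq_VNP ℂ hGRH hEq)

/-- Contrapositive, the GRH-conditional «CH ⊄ P/poly ⟹ VP ≠ VNP» through the route's summit decl.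
[cite: Burgisser2000, Cor. 1.2] -/
theorem valiant_of_ERH_of_ch_not_subset_PPoly (hGRH : ExtendedRiemannHypothesis) (h : ¬ CH ⊆ PPoly) :
    ValiantsHypothesis :=
  fun hEq => h (ch_subset_PPoly_of_ERH_of_collapse hGRH hEq)

end Summit.ValiantsHypothesis.ValiantsHypothesis.Theorems.VPBoundarySquareCHBooleanHalf
end
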